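import Literature.MathematicalPhysics.QuantumLattice.KomaPiFluxCoulombKLSInequality
import Literature.MathematicalPhysics.QuantumLattice.KomaPiFluxPrintedLongRangeOrder
import HarnessLib

/-!
# Direction independence of the nearest-neighbour `η` correlations of Koma's `π`-flux BCS model
# (Koma 2022, §4.2: "direction-independence of the hopping amplitudes in the sense of gauge equivalence")

T. Koma, *Nambu–Goldstone modes for superconducting lattice fermions*, arXiv:2201.13135 (2022)
[Koma2022], §4.2 (4.5)–(4.9) and the sentence before §4.1: the `π`-flux hopping (2.7)–(2.9) is not
literally invariant under interchanging the coordinate axes, but it is up to a `ℤ₂` gauge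
transformation, so "in the sense of the gauge equivalence, the present system has … direction-
independence". In (6.31)–(6.32) this is used in the form: the nearest-neighbour correlation
`Σ_x⟨Γ^a_xΓ^a_{x+e_m}⟩` does not depend on the direction `m`.

In the Lieb frame of this series the axis rotation `rotateAxes` composed with the `ℤ₂` gauge
`rotateGauge` is a symmetry of `T_π` (`KomaPiFlux.rotateGauge_bondSign`, `piFluxAmpl_map`, file
`KomaPiFluxGaussianDomination.lean`, where it was used for the partition function with a field).
This file records the consequence for Gibbs EXPECTATIONS of `H₀ = H(κ,U,g,0,B)`:

* `KomaPiFlux.gibbsState_map_eq` — for a symmetry `(f, π, ε)` of `T_π` up to a sign gauge and any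
  operator `A` fixed by sign gauges, `⟨relabel f A⟩_{β,H₀} = ⟨A⟩_{β,H₀}`;
* `KomaPiFlux.gibbsState_gamma{One,Two,Three}_mul_map` — `⟨Γ^a_{fx}Γ^a_{fy}⟩ = ⟨Γ^a_xΓ^a_y⟩`, `a = 1,2,3`;
* `KomaPiFlux.sum_pairCorr_shift_eq`, `sum_re_gibbsState_gammaTwo_mul_shift_eq`,
  `sum_re_gibbsState_gammaThree_mul_shift_eq` — **the nearest-neighbour correlations
  `Σ_x Re⟨Γ^a_xΓ^a_{x+e_ν}⟩_{β,H₀}` do not depend on the direction `ν`** (even `L ≥ 2`).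

Everything is PROVED (relabelling covariance `gibbsState_relabel`, gauge covariance of the
Hamiltonian `orbitalPhaseAut_hamiltonian`, unitary covariance of Gibbs states); no named fact.

## References

* [Koma2022] T. Koma, arXiv:2201.13135, §4.1–4.2 (4.1)–(4.9), (6.31)–(6.32).
* [Lieb1994] E. H. Lieb, Phys. Rev. Lett. 73 (1994) 2158, p. 3 (gauge transformations).
-/

noncomputable section

namespace Literature.MathematicalPhysics.QuantumLattice

open Matrix Finset HubbardWave0 PairHopRP FermionTorus LiebCutRP
open Literature.Probability.LatticeModels


namespace KomaPiFlux

attribute [local instance] LiebCutRP.decEqTorus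

variable {d L : ℕ} [NeZero L]

section Symmetry

variable {f : FermionTorus (d + 1) L ≃ FermionTorus (d + 1) L} {π : Equiv.Perm (Fin (d + 1))}
  {ε : FermionTorus (d + 1) L → ℝ}

/-- The orbital phases `(σ, x) ↦ ε(x)` of a `ℤ₂` (sign) gauge. [cite: Koma2022, §4.1 (4.1)] -/
def signPhase (ε : FermionTorus (d + 1) L → ℝ) : Fin 2 → FermionTorus (d + 1) L → ℂ := fun _ x => (ε x : ℂ)

omit [NeZero L] in
/-- `signPhase ε σ x = ε x`. [cite: Koma2022, §4.1 (4.1)] -/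
@[simp] theorem signPhase_apply (ε : FermionTorus (d + 1) L → ℝ) (σ : Fin 2) (x : FermionTorus (d + 1) L) :
    signPhase ε σ x = (ε x : ℂ) := rfl

omit [NeZero L] in
/-- The sign phases have norm one. [cite: Koma2022, §4.1 (4.1)] -/
theorem norm_signPhase (hε1 : ∀ x, ε x = 1 ∨ ε x = -1) (σ : Fin 2) (x : FermionTorus (d + 1) L) :
    ‖signPhase ε σ x‖ = 1 := by
  rcases hε1 x with h1 | h1 <;> simp [h1]

omit [NeZero L] in
/-- The sign phases satisfy `g_↑ g_↓ = 1`. [cite: Koma2022, §4.1 (4.1)] -/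
theorem signPhase_prod (hε1 : ∀ x, ε x = 1 ∨ ε x = -1) (x : FermionTorus (d + 1) L) :
    signPhase ε 0 x * signPhase ε 1 x = 1 := by
  rcases hε1 x with h1 | h1 <;> simp [h1]

/-- **The relabelled Hamiltonian is a gauge transform of the original one**: for a symmetry `(f, π, ε)`
of `T_π` up to the sign gauge `ε`, `relabel f (H(κ,U,g,0,B)) = 𝒟_{ε∘f⁻¹} H(κ,U,g,0,B) 𝒟_{ε∘f⁻¹}ᴴ`.
[cite: Koma2022, §4.1 (4.1)–(4.4), §4.2 (4.5)–(4.9)] -/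
theorem relabel_hamiltonian_eq_gauge (h2 : 2 ≤ L) (hf : ∀ x ν, f (shift x ν) = shift (f x) (π ν))
    (hε1 : ∀ x, ε x = 1 ∨ ε x = -1) (hε : ∀ x ν, ε x * ε (shift x ν) * bondSign x ν = bondSign (f x) (π ν))
    (κ U g B : ℝ) :
    relabel (Orb.mapEquiv f) (hamiltonian κ U g (fun (_ _ : FermionTorus (d + 1) L) => (0 : ℝ)) B) =
      orbitalPhaseAut (g := spinSitePhase (signPhase (fun x => ε (f.symm x))))
        (fun _ => norm_signPhase (ε := fun x => ε (f.symm x)) (fun x => hε1 (f.symm x)) _ _)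
        (hamiltonian κ U g (fun (_ _ : FermionTorus (d + 1) L) => (0 : ℝ)) B) := by
  have hG : ∀ x y, (G d L).Adj (f x) (f y) ↔ (G d L).Adj x y := fun x y => adj_map_iff h2 hf x y
  unfold hamiltonian
  rw [PairHopRP.relabel_hamiltonian (G d L) (G d L) f hG,
    PairHopRP.orbitalPhaseAut_hamiltonian (G d L)
      (fun σ x => norm_signPhase (ε := fun x => ε (f.symm x)) (fun x => hε1 (f.symm x)) σ x)
      (fun x => signPhase_prod (ε := fun x => ε (f.symm x)) (fun x => hε1 (f.symm x)) x)]
  congr 1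
  funext σ x' y'
  simp only [signPhase_apply]
  -- `T_π(f⁻¹x', f⁻¹y') = ε(f⁻¹x') ε(f⁻¹y') T_π(x', y')`
  have key := piFluxAmpl_map κ hf hε σ (f.symm x') (f.symm y')
  rw [Equiv.apply_symm_apply, Equiv.apply_symm_apply] at key
  have hsq : ∀ z, (ε z : ℂ) * ε z = 1 := fun z => by rcases hε1 z with h | h <;> simp [h]
  calc piFluxAmpl κ σ (f.symm x') (f.symm y')
      = ((ε (f.symm x') : ℂ) * ε (f.symm x')) * ((ε (f.symm y') : ℂ) * ε (f.symm y')) *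
          piFluxAmpl κ σ (f.symm x') (f.symm y') := by rw [hsq, hsq, one_mul, one_mul]
    _ = (ε (f.symm x') : ℂ) * (ε (f.symm y') : ℂ) * (((ε (f.symm x') * ε (f.symm y') : ℝ) : ℂ) *
          piFluxAmpl κ σ (f.symm x') (f.symm y')) := by push_cast; ring
    _ = (ε (f.symm x') : ℂ) * star ((ε (f.symm y') : ℂ)) * piFluxAmpl κ σ x' y' := by
          rw [← key, Complex.star_def, Complex.conj_ofReal]

/-- **Invariance of Gibbs expectations under a gauge-symmetry of `T_π`**: if `A` is fixed by every
sign gauge `𝒟_η A 𝒟_ηᴴ = A`, then `⟨relabel f A⟩_{β,H₀} = ⟨A⟩_{β,H₀}` for `H₀ = H(κ,U,g,0,B)`.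
[cite: Koma2022, §4.1–4.2] -/
theorem gibbsState_relabel_eq (h2 : 2 ≤ L) (hf : ∀ x ν, f (shift x ν) = shift (f x) (π ν))
    (hε1 : ∀ x, ε x = 1 ∨ ε x = -1) (hε : ∀ x ν, ε x * ε (shift x ν) * bondSign x ν = bondSign (f x) (π ν))
    (β κ U g B : ℝ) {A : Matrix (Finset (Orb (FermionTorus (d + 1) L))) (Finset (Orb (FermionTorus (d + 1) L))) ℂ}
    (hA : ∀ (η : FermionTorus (d + 1) L → ℝ) (hη : ∀ x, η x = 1 ∨ η x = -1),
      orbitalPhaseAut (g := spinSitePhase (signPhase η)) (fun _ => norm_signPhase hη _ _) (relabel (Orb.mapEquiv f) A) =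
        relabel (Orb.mapEquiv f) A) :
    gibbsState β (hamiltonian κ U g (fun (_ _ : FermionTorus (d + 1) L) => (0 : ℝ)) B) (relabel (Orb.mapEquiv f) A) =
      gibbsState β (hamiltonian κ U g (fun (_ _ : FermionTorus (d + 1) L) => (0 : ℝ)) B) A := by
  have hη1 : ∀ x, (fun x => ε (f.symm x)) x = 1 ∨ (fun x => ε (f.symm x)) x = -1 := fun x => hε1 (f.symm x)
  have hn : ∀ i, ‖spinSitePhase (signPhase (fun x => ε (f.symm x))) i‖ = 1 := fun _ => norm_signPhase hη1 _ _
  have hU := orbitalPhase_mem_unitary hn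
  -- `⟨relabel A⟩_{relabel H₀} = ⟨relabel A⟩_{𝒟 H₀ 𝒟ᴴ} = ⟨𝒟 (relabel A) 𝒟ᴴ⟩_{𝒟H₀𝒟ᴴ} = ⟨relabel A⟩_{H₀}`
  have key := Matrix.gibbsState_unitary_conj' hU β (hamiltonian κ U g (fun (_ _ : FermionTorus (d + 1) L) => (0 : ℝ)) B)
    (relabel (Orb.mapEquiv f) A)
  rw [star_eq_conjTranspose, ← orbitalPhaseAut_apply hn, ← orbitalPhaseAut_apply hn, hA _ hη1,
    ← relabel_hamiltonian_eq_gauge h2 hf hε1 hε κ U g B, gibbsState_relabel] at key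
  exact key.symm

/-- `⟨Γ¹_{fx}Γ¹_{fy}⟩ = ⟨Γ¹_xΓ¹_y⟩`. [cite: Koma2022, §4.1 (4.1)–(4.4), §4.2] -/
theorem gibbsState_gammaOne_mul_map (h2 : 2 ≤ L) (hf : ∀ x ν, f (shift x ν) = shift (f x) (π ν))
    (hε1 : ∀ x, ε x = 1 ∨ ε x = -1) (hε : ∀ x ν, ε x * ε (shift x ν) * bondSign x ν = bondSign (f x) (π ν))
    (β κ U g B : ℝ) (x y : FermionTorus (d + 1) L) :
    gibbsState β (hamiltonian κ U g (fun (_ _ : FermionTorus (d + 1) L) => (0 : ℝ)) B) (gammaOne (f x) * gammaOne (f y)) =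
      gibbsState β (hamiltonian κ U g (fun (_ _ : FermionTorus (d + 1) L) => (0 : ℝ)) B) (gammaOne x * gammaOne y) := by
  have h := gibbsState_relabel_eq h2 hf hε1 hε β κ U g B (A := gammaOne x * gammaOne y) (fun η hη => by
    rw [map_mul, relabel_gammaOne, relabel_gammaOne, map_mul,
      PairHopRP.orbitalPhaseAut_gammaOne (fun σ x => norm_signPhase hη σ x) (signPhase_prod hη),
      PairHopRP.orbitalPhaseAut_gammaOne (fun σ x => norm_signPhase hη σ x) (signPhase_prod hη)])
  rwa [map_mul, relabel_gammaOne, relabel_gammaOne] at h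

/-- `⟨Γ²_{fx}Γ²_{fy}⟩ = ⟨Γ²_xΓ²_y⟩`. [cite: Koma2022, §4.1 (4.1)–(4.4), §4.2] -/
theorem gibbsState_gammaTwo_mul_map (h2 : 2 ≤ L) (hf : ∀ x ν, f (shift x ν) = shift (f x) (π ν))
    (hε1 : ∀ x, ε x = 1 ∨ ε x = -1) (hε : ∀ x ν, ε x * ε (shift x ν) * bondSign x ν = bondSign (f x) (π ν))
    (β κ U g B : ℝ) (x y : FermionTorus (d + 1) L) :
    gibbsState β (hamiltonian κ U g (fun (_ _ : FermionTorus (d + 1) L) => (0 : ℝ)) B) (gammaTwo (f x) * gammaTwo (f y)) =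
      gibbsState β (hamiltonian κ U g (fun (_ _ : FermionTorus (d + 1) L) => (0 : ℝ)) B) (gammaTwo x * gammaTwo y) := by
  have h := gibbsState_relabel_eq h2 hf hε1 hε β κ U g B (A := gammaTwo x * gammaTwo y) (fun η hη => by
    rw [map_mul, relabel_gammaTwo, relabel_gammaTwo, map_mul,
      PairHopRP.orbitalPhaseAut_gammaTwo (fun σ x => norm_signPhase hη σ x) (signPhase_prod hη),
      PairHopRP.orbitalPhaseAut_gammaTwo (fun σ x => norm_signPhase hη σ x) (signPhase_prod hη)])
  rwa [map_mul, relabel_gammaTwo, relabel_gammaTwo] at h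

/-- `⟨Γ³_{fx}Γ³_{fy}⟩ = ⟨Γ³_xΓ³_y⟩`. [cite: Koma2022, §4.1 (4.1)–(4.4), §4.2] -/
theorem gibbsState_gammaThree_mul_map (h2 : 2 ≤ L) (hf : ∀ x ν, f (shift x ν) = shift (f x) (π ν))
    (hε1 : ∀ x, ε x = 1 ∨ ε x = -1) (hε : ∀ x ν, ε x * ε (shift x ν) * bondSign x ν = bondSign (f x) (π ν))
    (β κ U g B : ℝ) (x y : FermionTorus (d + 1) L) :
    gibbsState β (hamiltonian κ U g (fun (_ _ : FermionTorus (d + 1) L) => (0 : ℝ)) B) (gammaThree (f x) * gammaThree (f y)) =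
      gibbsState β (hamiltonian κ U g (fun (_ _ : FermionTorus (d + 1) L) => (0 : ℝ)) B) (gammaThree x * gammaThree y) := by
  have h := gibbsState_relabel_eq h2 hf hε1 hε β κ U g B (A := gammaThree x * gammaThree y) (fun η hη => by
    rw [map_mul, relabel_gammaThree, relabel_gammaThree, map_mul,
      PairHopRP.orbitalPhaseAut_gammaThree (fun σ x => norm_signPhase hη σ x),
      PairHopRP.orbitalPhaseAut_gammaThree (fun σ x => norm_signPhase hη σ x)])
  rwa [map_mul, relabel_gammaThree, relabel_gammaThree] at h

/-- **Transport of a nearest-neighbour sum along a symmetry**: if `F(f x, f y) = F(x, y)` for all `x, y`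
and `f` maps `e_ν`-bonds to `e_{πν}`-bonds, then `Σ_x F(x, x+e_ν) = Σ_x F(x, x+e_{πν})`.
[cite: Koma2022, §4.2] -/
theorem sum_shift_eq_of_map (hf : ∀ x ν, f (shift x ν) = shift (f x) (π ν)) {F : FermionTorus (d + 1) L → FermionTorus (d + 1) L → ℝ}
    (hF : ∀ x y, F (f x) (f y) = F x y) (ν : Fin (d + 1)) :
    ∑ x : FermionTorus (d + 1) L, F x (shift x ν) = ∑ x : FermionTorus (d + 1) L, F x (shift x (π ν)) := by
  calc ∑ x : FermionTorus (d + 1) L, F x (shift x ν)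
      = ∑ x : FermionTorus (d + 1) L, F (f x) (f (shift x ν)) := Finset.sum_congr rfl fun x _ => (hF x _).symm
    _ = ∑ x : FermionTorus (d + 1) L, F (f x) (shift (f x) (π ν)) := Finset.sum_congr rfl fun x _ => by rw [hf]
    _ = ∑ x : FermionTorus (d + 1) L, F x (shift x (π ν)) := f.sum_comp (fun x => F x (shift x (π ν)))

end Symmetry

/-! ### The axis rotation: all directions are equivalent -/

omit [NeZero L] in
/-- If a function of the directions is invariant under `finRotate⁻¹`, it is constant. [cite: Koma2022, §4.2] -/
theorem eq_zero_dir_of_finRotate_symm {N : Fin (d + 1) → ℝ} (hN : ∀ ν, N ν = N ((finRotate (d + 1)).symm ν))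
    (ν : Fin (d + 1)) : N ν = N 0 := by
  have hstep : ∀ μ, N (finRotate (d + 1) μ) = N μ := fun μ => by
    rw [hN (finRotate (d + 1) μ), Equiv.symm_apply_apply]
  have hpow : ∀ (r : ℕ) μ, N (((finRotate (d + 1)) ^ r) μ) = N μ := by
    intro r
    induction r with
    | zero => intro μ; rw [pow_zero, Equiv.Perm.one_apply]
    | succ r ih => intro μ; rw [pow_succ, Equiv.Perm.mul_apply, ih, hstep]
  obtain ⟨r, hr⟩ := finRotate_pow_eq_zero ν
  rw [← hpow r ν, hr]

/-- **The nearest-neighbour `Γ¹` correlation does not depend on the direction**: for `H₀ = H(κ,U,g,0,B)`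
on the even torus of side `L ≥ 2`, `Σ_x Re⟨Γ¹_xΓ¹_{x+e_ν}⟩_{β,H₀} = Σ_x Re⟨Γ¹_xΓ¹_{x+e₀}⟩_{β,H₀}` for every `ν`.
[cite: Koma2022, §4.2, (6.31)–(6.32)] -/
theorem sum_pairCorr_shift_eq (hL : Even L) (h2 : 2 ≤ L) (β κ U g B : ℝ) (ν : Fin (d + 1)) :
    ∑ x : FermionTorus (d + 1) L, pairCorr β (hamiltonian κ U g (fun (_ _ : FermionTorus (d + 1) L) => (0 : ℝ)) B) x (shift x ν) =
      ∑ x : FermionTorus (d + 1) L, pairCorr β (hamiltonian κ U g (fun (_ _ : FermionTorus (d + 1) L) => (0 : ℝ)) B) x (shift x 0) := by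
  refine eq_zero_dir_of_finRotate_symm (N := fun ν => ∑ x : FermionTorus (d + 1) L,
    pairCorr β (hamiltonian κ U g (fun (_ _ : FermionTorus (d + 1) L) => (0 : ℝ)) B) x (shift x ν)) (fun ν => ?_) ν
  exact sum_shift_eq_of_map rotateAxes_shift
    (F := fun x y => pairCorr β (hamiltonian κ U g (fun (_ _ : FermionTorus (d + 1) L) => (0 : ℝ)) B) x y)
    (fun x y => by
      unfold pairCorr
      rw [gibbsState_gammaOne_mul_map h2 rotateAxes_shift rotateGauge_sign (rotateGauge_bondSign hL)]) ν

/-- **The nearest-neighbour `Γ²` correlation does not depend on the direction.** [cite: Koma2022, §4.2, (6.31)] -/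
theorem sum_re_gibbsState_gammaTwo_mul_shift_eq (hL : Even L) (h2 : 2 ≤ L) (β κ U g B : ℝ) (ν : Fin (d + 1)) :
    ∑ x : FermionTorus (d + 1) L,
        (gibbsState β (hamiltonian κ U g (fun (_ _ : FermionTorus (d + 1) L) => (0 : ℝ)) B) (gammaTwo x * gammaTwo (shift x ν))).re =
      ∑ x : FermionTorus (d + 1) L,
        (gibbsState β (hamiltonian κ U g (fun (_ _ : FermionTorus (d + 1) L) => (0 : ℝ)) B) (gammaTwo x * gammaTwo (shift x 0))).re := by
  refine eq_zero_dir_of_finRotate_symm (N := fun ν => ∑ x : FermionTorus (d + 1) L,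
    (gibbsState β (hamiltonian κ U g (fun (_ _ : FermionTorus (d + 1) L) => (0 : ℝ)) B) (gammaTwo x * gammaTwo (shift x ν))).re)
    (fun ν => ?_) ν
  exact sum_shift_eq_of_map rotateAxes_shift
    (F := fun x y => (gibbsState β (hamiltonian κ U g (fun (_ _ : FermionTorus (d + 1) L) => (0 : ℝ)) B)
      (gammaTwo x * gammaTwo y)).re)
    (fun x y => by
      rw [gibbsState_gammaTwo_mul_map h2 rotateAxes_shift rotateGauge_sign (rotateGauge_bondSign hL)]) ν

/-- **The nearest-neighbour `Γ³` (density) correlation does not depend on the direction.**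
[cite: Koma2022, §4.2, (6.28)] -/
theorem sum_re_gibbsState_gammaThree_mul_shift_eq (hL : Even L) (h2 : 2 ≤ L) (β κ U g B : ℝ) (ν : Fin (d + 1)) :
    ∑ x : FermionTorus (d + 1) L,
        (gibbsState β (hamiltonian κ U g (fun (_ _ : FermionTorus (d + 1) L) => (0 : ℝ)) B) (gammaThree x * gammaThree (shift x ν))).re =
      ∑ x : FermionTorus (d + 1) L,
        (gibbsState β (hamiltonian κ U g (fun (_ _ : FermionTorus (d + 1) L) => (0 : ℝ)) B) (gammaThree x * gammaThree (shift x 0))).re := by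
  refine eq_zero_dir_of_finRotate_symm (N := fun ν => ∑ x : FermionTorus (d + 1) L,
    (gibbsState β (hamiltonian κ U g (fun (_ _ : FermionTorus (d + 1) L) => (0 : ℝ)) B) (gammaThree x * gammaThree (shift x ν))).re)
    (fun ν => ?_) ν
  exact sum_shift_eq_of_map rotateAxes_shift
    (F := fun x y => (gibbsState β (hamiltonian κ U g (fun (_ _ : FermionTorus (d + 1) L) => (0 : ℝ)) B)
      (gammaThree x * gammaThree y)).re)
    (fun x y => by
      rw [gibbsState_gammaThree_mul_map h2 rotateAxes_shift rotateGauge_sign (rotateGauge_bondSign hL)]) ν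

end KomaPiFlux

end Literature.MathematicalPhysics.QuantumLattice

end
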